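import Summits.QuantumAdvantage.QuantumAdvantage.Theorems.CharDialTowerD
import Summits.QuantumAdvantage.QuantumAdvantage.Theorems.CharDialTowerDefs
import HarnessLib

/-!
# CharDial / JLinPeel — dial tower, part E: BRIDGES from the definitions-only vocabulary `TowerDefs.*` to the theorems side `Tower.*`
(route `CharDial`, item 32604; lens-6 node g18 §11.6; writer l.1737/l.1750)

Every `TowerDefs.X` is the verbatim text of `Tower.X`, so each bridge is `Iff.rfl` / `rfl`.  In the ITEM vocabulary (importable by the route file):
* `closes_split`      : `TowerDefs.LowResidual5Side TowerDefs.dialB → TowerDefs.ResidualHigh5Side TowerDefs.dialB → CharDial.WalkHardFJLinOdd`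
  (the deciding theorem of the split of 32604 — the one-line Theorems closer of the glue item is `:= TowerDefs.closes_split`);
* `split_of_closes`   : the crux gives both pieces back (exactness);
* `walkHardFJLinOdd_iff_residual5_split` : `T ↔ LOW-RESIDUAL⁵ ∧ RESIDUAL-HIGH⁵` at schedule `dialB`;
* `residualHigh5_class_inhabited` / `residualHigh5_nonvacuous` : the residual's hypothesis class is INHABITED (generic field-trace columns,
  `Theorems.CharDialTowerD` / `CharDialFieldColF`), so the residual is tested non-vacuously (T3 witness side).
0 sorry.
-/

set_option autoImplicit false

namespace Summit.QuantumAdvantage.AdviceFreeQNC0.JLinPeel.TowerDefs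

open Finset

variable {n : ℕ} {p : ℕ}

/-- bridge (`Iff.rfl`). -/
theorem jlinHyp_iff (p n : ℕ) (y : Fin (n + 1) → (Fin n → Bool) → Bool) : TowerDefs.JLinHyp p n y ↔ Tower.JLinHyp p n y := Iff.rfl

/-- bridge (`Iff.rfl`). -/
theorem lowVar_iff (B : ℕ → ℕ) (n : ℕ) (y : Fin (n + 1) → (Fin n → Bool) → Bool) : TowerDefs.LowVar B n y ↔ Tower.LowVar B n y := Iff.rfl

/-- bridge (`rfl`). -/
theorem dialB_eq : TowerDefs.dialB = Tower.dialB := rfl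

/-- bridge (`rfl`): the copied cube-root rate is `JLinPeel.cubeRate`. -/
theorem cubeRate_eq (n : ℕ) : TowerDefs.cubeRate n = JLinPeel.cubeRate n := rfl

/-- bridge (`Iff.rfl`). -/
theorem spanHyp_iff (D : JLinPeel.JLinData p n) : TowerDefs.SpanHyp D ↔ Tower.SpanHyp D := Iff.rfl

/-- bridge (`Iff.rfl`). -/
theorem sparseHyp_iff (D : JLinPeel.JLinData p n) : TowerDefs.SparseHyp D ↔ Tower.SparseHyp D := Iff.rfl

/-- bridge (`Iff.rfl`). -/
theorem blockHyp_iff (D : JLinPeel.JLinData p n) : TowerDefs.BlockHyp D ↔ Tower.BlockHyp D := Iff.rfl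

/-- bridge (`Iff.rfl`). -/
theorem nullHyp_iff (D : JLinPeel.JLinData p n) : TowerDefs.NullHyp D ↔ Tower.NullHyp D := Iff.rfl

/-- bridge (`Iff.rfl`). -/
theorem maskHyp_iff (D : JLinPeel.JLinData p n) : TowerDefs.MaskHyp D ↔ Tower.MaskHyp D := Iff.rfl

/-- bridge (`Iff.rfl`). -/
theorem lowSide_iff (B : ℕ → ℕ) : TowerDefs.LowSide B ↔ Tower.LowSide B := Iff.rfl

/-- bridge (`Iff.rfl`). -/
theorem highSide_iff (B : ℕ → ℕ) : TowerDefs.HighSide B ↔ Tower.HighSide B := Iff.rfl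

/-- bridge (`Iff.rfl`). -/
theorem residualHigh5Side_iff (B : ℕ → ℕ) : TowerDefs.ResidualHigh5Side B ↔ Tower.ResidualHigh5Side B := Iff.rfl

/-- bridge (`Iff.rfl`). -/
theorem lowResidual5Side_iff (B : ℕ → ℕ) : TowerDefs.LowResidual5Side B ↔ Tower.LowResidual5Side B := Iff.rfl

/-- bridge (`Iff.rfl`). -/
theorem residual5Side_iff : TowerDefs.Residual5Side ↔ Tower.Residual5Side := Iff.rfl

/-- ★ **JUNCTION (by name, item vocabulary): T ⟺ its five-dial residual.** -/
theorem walkHardFJLinOdd_iff_residual5 :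
    Summit.QuantumAdvantage.QuantumAdvantage.Theses.CharDial.WalkHardFJLinOdd ↔ TowerDefs.Residual5Side :=
  Tower.walkHardFJLinOdd_iff_residual5

/-- ★ **JUNCTION (by name, item vocabulary): T ⟺ LOW-RESIDUAL⁵ ∧ RESIDUAL-HIGH⁵**, every schedule `B`. -/
theorem walkHardFJLinOdd_iff_residual5_split (B : ℕ → ℕ) :
    Summit.QuantumAdvantage.QuantumAdvantage.Theses.CharDial.WalkHardFJLinOdd ↔
      TowerDefs.LowResidual5Side B ∧ TowerDefs.ResidualHigh5Side B :=
  Tower.walkHardFJLinOdd_iff_residual5_split B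

/-- the two one-sided pieces are the dial's LOW / HIGH pieces (all five decided dials absorbed), item vocabulary. -/
theorem lowSide_iff_lowResidual5 (B : ℕ → ℕ) : TowerDefs.LowSide B ↔ TowerDefs.LowResidual5Side B :=
  Tower.lowSide_iff_lowResidual5 B

/-- the two one-sided pieces are the dial's LOW / HIGH pieces (all five decided dials absorbed), item vocabulary. -/
theorem highSide_iff_residualHigh5 (B : ℕ → ℕ) : TowerDefs.HighSide B ↔ TowerDefs.ResidualHigh5Side B :=
  Tower.highSide_iff_residualHigh5 B

/-- ★★ **the DECIDING THEOREM of the split of 32604, item vocabulary** (the glue item's one-line closer is `:= TowerDefs.closes_split`). -/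
theorem closes_split (hL : TowerDefs.LowResidual5Side TowerDefs.dialB) (hH : TowerDefs.ResidualHigh5Side TowerDefs.dialB) :
    Summit.QuantumAdvantage.QuantumAdvantage.Theses.CharDial.WalkHardFJLinOdd :=
  Tower.closes_split hL hH

/-- the split is EXACT (item vocabulary): the crux gives both pieces back. -/
theorem split_of_closes (hT : Summit.QuantumAdvantage.QuantumAdvantage.Theses.CharDial.WalkHardFJLinOdd) :
    TowerDefs.LowResidual5Side TowerDefs.dialB ∧ TowerDefs.ResidualHigh5Side TowerDefs.dialB :=
  Tower.split_of_closes hT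

/-- ★★★ **class(RESIDUAL-HIGH⁵) IS INHABITED, item vocabulary**: for every prime `p ≥ 5` and all large `n` some strategy satisfies the JLin hypothesis,
lies on the HIGH side of the variation dial at schedule `dialB`, and escapes all five decided dials in EVERY `log₂ n`-junta ⊕ one-form presentation. -/
theorem residualHigh5_class_inhabited (p : ℕ) [Fact p.Prime] (hp5 : 5 ≤ p) :
    ∃ n₁ : ℕ, ∀ n ≥ n₁, ∃ y : Fin (n + 1) → (Fin n → Bool) → Bool,
      TowerDefs.JLinHyp p n y ∧ ¬ TowerDefs.LowVar TowerDefs.dialB n y ∧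
      ∀ D : JLinPeel.JLinData p n, D.strat = y → (∀ g, (D.J g).card ≤ Nat.log 2 n) →
        ¬ TowerDefs.SpanHyp D ∧ ¬ TowerDefs.SparseHyp D ∧ ¬ TowerDefs.BlockHyp D ∧ ¬ TowerDefs.NullHyp D ∧ ¬ TowerDefs.MaskHyp D :=
  Tower.residualHigh5_class_inhabited p hp5

/-- ★ the residual piece is tested NON-VACUOUSLY (item vocabulary). -/
theorem residualHigh5_nonvacuous (hR : TowerDefs.ResidualHigh5Side TowerDefs.dialB) (p : ℕ) [Fact p.Prime] (hp5 : 5 ≤ p) :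
    ∃ θ : ℝ, θ < 1 ∧ ∃ n₀ : ℕ, ∀ n ≥ n₀, ∃ y : Fin (n + 1) → (Fin n → Bool) → Bool,
      TowerDefs.JLinHyp p n y ∧ ¬ TowerDefs.LowVar TowerDefs.dialB n y ∧ ∀ c : ℕ,
        ((Finset.univ.filter fun u : Fin n → Bool => ringWinU c y u = true).card : ℝ) ≤ θ * (2 : ℝ) ^ n :=
  Tower.residualHigh5_nonvacuous hR p hp5

end Summit.QuantumAdvantage.AdviceFreeQNC0.JLinPeel.TowerDefs
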